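import Summits.QuantumFields.YangMills.Theorems.ColdStartUniversalityLatticeLangevinLatitudeAlgebra
import Summits.QuantumFields.YangMills.Theorems.ColdStartUniversalityLatticeLangevinHeatKernelSU2
import Mathlib.Analysis.Calculus.MeanValue
import HarnessLib

/-!
# Route `ColdStartUniversality` (fixed-cut-off package, Bakry–Émery side, GRADIENT half): a NORM-CONTROLLED EXPONENTIAL CHART ON `SU(2)` —
# every `U ∈ SU(2)` is `exp X` with `X ∈ 𝔰𝔲(2)` and `⟨X, X⟩_HS = Re tr(X Xᴴ) ≤ 2π²`

Helper file (seat `ym-line-csu-p1`, g29; `--supports stmt-QuantumFields-24809`).  The geometric input for turning the Lipschitz (carré du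
champ) bounds of the gradient-bound package (`wilson_lipschitz_contraction_uniform`, `wilson_lipschitz_smoothing_uniform`, g29) into OSCILLATION
and hence POINTWISE bounds: a path of controlled length from `1` to any element of `SU(2)` (the tree's `ExpSurjectiveConnectedSubgroup`
is norm-free).  Elementary `2 × 2` proof:
* `su2_conjTranspose_eq`, `su2_mul_self_eq`, `su2_sub_smul_one_mul_self`, `su2_sub_smul_one_skew`, `su2_sub_smul_one_trace` —
  Cayley–Hamilton for `U ∈ SU(2)`: `Uᴴ = (Re tr U)·1 − U`, `U² = (Re tr U)·U − 1`, `(U − c·1)² = (c² − 1)·1` with `c = Re tr U / 2`,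
  and `U − c·1 ∈ 𝔰𝔲(2)`;
* ★ `exp_smul_of_mul_self_eq_neg_one` — `exp(θJ) = cos θ·1 + sin θ·J` whenever `J² = −1` (ODE argument: `e^(θJ)·R(−θ)` is constant);
* ★★ `exists_su2_generator_norm_le` — for every `U ∈ SU(2)` there is `X` with `Xᴴ = −X`, `tr X = 0`, `exp X = U` and `⟨X, X⟩_HS ≤ 2π²`
  (`X = θJ`, `J = (U − c·1)/sin θ`, `θ = arccos c`; `U = ±1` separately).
THEOREMS ONLY, no definition, no sorry; all [folklore].  HONEST FRAMING: elementary Lie-group geometry; no statement about Yang–Mills; the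
Yang–Mills mass gap is NOT proved.
-/

set_option autoImplicit false

noncomputable section

namespace Summit.QuantumFields.YangMills.Theorems.ColdStartUniversality

open Matrix Complex Finset
open scoped ComplexConjugate BigOperators Matrix
open Literature.MathematicalPhysics.QuantumFieldTheory
open Literature.MathematicalPhysics.QuantumLattice (fundamentalRep fundamentalLatticeRep continuous_fundamentalRep fundamentalRep_apply)

/-! ## §1. Cayley–Hamilton for `SU(2)` -/

/-- `Uᴴ = (Re tr U)·1 − U` for `U ∈ SU(2)`. [folklore] -/
theorem su2_conjTranspose_eq (k : Matrix.specialUnitaryGroup (Fin 2) ℂ) :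
    (k : Matrix (Fin 2) (Fin 2) ℂ)ᴴ = (((k : Matrix (Fin 2) (Fin 2) ℂ).trace.re : ℝ) : ℂ) • (1 : Matrix (Fin 2) (Fin 2) ℂ) - (k : Matrix (Fin 2) (Fin 2) ℂ) := by
  have h := fundamentalRep_add_conjTranspose k
  rw [fundamentalRep_apply] at h
  rw [← h]; abel

/-- `U·U = (Re tr U)·U − 1` for `U ∈ SU(2)`. [folklore] -/
theorem su2_mul_self_eq (k : Matrix.specialUnitaryGroup (Fin 2) ℂ) :
    (k : Matrix (Fin 2) (Fin 2) ℂ) * (k : Matrix (Fin 2) (Fin 2) ℂ) =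
      (((k : Matrix (Fin 2) (Fin 2) ℂ).trace.re : ℝ) : ℂ) • (k : Matrix (Fin 2) (Fin 2) ℂ) - 1 := by
  set U : Matrix (Fin 2) (Fin 2) ℂ := (k : Matrix (Fin 2) (Fin 2) ℂ) with hU
  have hunit : U * Uᴴ = 1 := by
    have hk : U ∈ Matrix.unitaryGroup (Fin 2) ℂ := Matrix.specialUnitaryGroup_le_unitaryGroup k.2
    rw [← Matrix.star_eq_conjTranspose]
    exact Matrix.mem_unitaryGroup_iff.1 hk
  have h1 : U * (U + Uᴴ) = U * ((((U.trace.re : ℝ) : ℂ)) • (1 : Matrix (Fin 2) (Fin 2) ℂ)) := by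
    rw [su2_conjTranspose_eq k, add_sub_cancel]
  rw [mul_add, hunit, Matrix.mul_smul, mul_one] at h1
  exact eq_sub_of_add_eq h1

/-- `(U − c·1)·(U − c·1) = (c² − 1)·1` for `U ∈ SU(2)`, `c = Re tr U / 2` (Cayley–Hamilton). [folklore] -/
theorem su2_sub_smul_one_mul_self (k : Matrix.specialUnitaryGroup (Fin 2) ℂ) :
    ((k : Matrix (Fin 2) (Fin 2) ℂ) - ((((k : Matrix (Fin 2) (Fin 2) ℂ).trace.re / 2 : ℝ) : ℂ)) • (1 : Matrix (Fin 2) (Fin 2) ℂ)) *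
      ((k : Matrix (Fin 2) (Fin 2) ℂ) - ((((k : Matrix (Fin 2) (Fin 2) ℂ).trace.re / 2 : ℝ) : ℂ)) • (1 : Matrix (Fin 2) (Fin 2) ℂ)) =
      (((((k : Matrix (Fin 2) (Fin 2) ℂ).trace.re / 2 : ℝ) : ℂ)) ^ 2 - 1) • (1 : Matrix (Fin 2) (Fin 2) ℂ) := by
  set U : Matrix (Fin 2) (Fin 2) ℂ := (k : Matrix (Fin 2) (Fin 2) ℂ) with hU
  set c : ℂ := (((U.trace.re / 2 : ℝ)) : ℂ) with hc
  have ht : (((U.trace.re : ℝ)) : ℂ) = 2 * c := by rw [hc]; push_cast; ring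
  have hUU : U * U = (2 * c) • U - 1 := by rw [← ht]; exact su2_mul_self_eq k
  calc (U - c • (1 : Matrix (Fin 2) (Fin 2) ℂ)) * (U - c • (1 : Matrix (Fin 2) (Fin 2) ℂ))
      = U * U - c • U - c • U + (c * c) • (1 : Matrix (Fin 2) (Fin 2) ℂ) := by
        simp only [sub_mul, mul_sub, smul_mul_assoc, mul_smul_comm, one_mul, mul_one]
        module
    _ = (c ^ 2 - 1) • (1 : Matrix (Fin 2) (Fin 2) ℂ) := by rw [hUU]; module

/-- `(U − c·1)ᴴ = −(U − c·1)` for `U ∈ SU(2)`, `c = Re tr U / 2`. [folklore] -/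
theorem su2_sub_smul_one_skew (k : Matrix.specialUnitaryGroup (Fin 2) ℂ) :
    ((k : Matrix (Fin 2) (Fin 2) ℂ) - ((((k : Matrix (Fin 2) (Fin 2) ℂ).trace.re / 2 : ℝ) : ℂ)) • (1 : Matrix (Fin 2) (Fin 2) ℂ))ᴴ =
      -((k : Matrix (Fin 2) (Fin 2) ℂ) - ((((k : Matrix (Fin 2) (Fin 2) ℂ).trace.re / 2 : ℝ) : ℂ)) • (1 : Matrix (Fin 2) (Fin 2) ℂ)) := by
  set U : Matrix (Fin 2) (Fin 2) ℂ := (k : Matrix (Fin 2) (Fin 2) ℂ) with hU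
  have hH := su2_conjTranspose_eq k
  rw [Matrix.conjTranspose_sub, Matrix.conjTranspose_smul, Matrix.conjTranspose_one, hH]
  have hstar : star ((((U.trace.re / 2 : ℝ)) : ℂ)) = (((U.trace.re / 2 : ℝ)) : ℂ) := Complex.conj_ofReal _
  rw [hstar]
  have ht : (((U.trace.re : ℝ)) : ℂ) = 2 * (((U.trace.re / 2 : ℝ)) : ℂ) := by push_cast; ring
  rw [ht]
  module

/-- `tr(U − c·1) = 0` for `U ∈ SU(2)`, `c = Re tr U / 2`. [folklore] -/
theorem su2_sub_smul_one_trace (k : Matrix.specialUnitaryGroup (Fin 2) ℂ) :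
    ((k : Matrix (Fin 2) (Fin 2) ℂ) - ((((k : Matrix (Fin 2) (Fin 2) ℂ).trace.re / 2 : ℝ) : ℂ)) • (1 : Matrix (Fin 2) (Fin 2) ℂ)).trace = 0 := by
  have htr := trace_fundamentalRep_eq k
  rw [fundamentalRep_apply] at htr
  rw [Matrix.trace_sub, Matrix.trace_smul, Matrix.trace_one, Fintype.card_fin, smul_eq_mul]
  nth_rewrite 1 [htr]
  push_cast; ring

/-! ## §2. `exp(θJ) = cos θ·1 + sin θ·J` for `J² = −1` -/

section Exp

open scoped Matrix.Norms.Operator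

/-- ★ **`exp(θJ) = cos θ·1 + sin θ·J`** for a `2 × 2` complex matrix `J` with `J·J = −1` (`t ↦ e^(tJ)·(cos t·1 − sin t·J)` has zero
derivative). [folklore] -/
theorem exp_smul_of_mul_self_eq_neg_one {J : Matrix (Fin 2) (Fin 2) ℂ} (hJ : J * J = -1) (θ : ℝ) :
    NormedSpace.exp (((θ : ℝ) : ℂ) • J) = ((Real.cos θ : ℝ) : ℂ) • (1 : Matrix (Fin 2) (Fin 2) ℂ) + ((Real.sin θ : ℝ) : ℂ) • J := by
  -- `R t = cos t·1 + sin t·J`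
  set R : ℝ → Matrix (Fin 2) (Fin 2) ℂ := fun t => ((Real.cos t : ℝ) : ℂ) • (1 : Matrix (Fin 2) (Fin 2) ℂ) + ((Real.sin t : ℝ) : ℂ) • J with hR
  have hRder : ∀ t, HasDerivAt R (((-Real.sin t : ℝ) : ℂ) • (1 : Matrix (Fin 2) (Fin 2) ℂ) + ((Real.cos t : ℝ) : ℂ) • J) t := by
    intro t
    have h1 : HasDerivAt (fun t : ℝ => ((Real.cos t : ℝ) : ℂ)) (((-Real.sin t : ℝ) : ℂ)) t := (Real.hasDerivAt_cos t).ofReal_comp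
    have h2 : HasDerivAt (fun t : ℝ => ((Real.sin t : ℝ) : ℂ)) (((Real.cos t : ℝ) : ℂ)) t := (Real.hasDerivAt_sin t).ofReal_comp
    exact (h1.smul_const (1 : Matrix (Fin 2) (Fin 2) ℂ)).add (h2.smul_const J)
  have hJR : ∀ t, J * R t = ((-Real.sin t : ℝ) : ℂ) • (1 : Matrix (Fin 2) (Fin 2) ℂ) + ((Real.cos t : ℝ) : ℂ) • J := by
    intro t
    rw [hR]
    simp only [mul_add, mul_smul_comm, mul_one, hJ, smul_neg, Complex.ofReal_neg, neg_smul]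
    abel
  -- derivatives of `exp(tJ)` and of `R(−t)`
  have hE : ∀ t : ℝ, HasDerivAt (fun t : ℝ => NormedSpace.exp (((t : ℝ) : ℂ) • J)) (J * NormedSpace.exp (((t : ℝ) : ℂ) • J)) t :=
    fun t => hasDerivAt_exp_smul_const' (𝕂 := ℝ) J t
  have hRneg : ∀ t, HasDerivAt (fun t : ℝ => R (-t)) (-(J * R (-t))) t := by
    intro t
    have h := (hRder (-t)).scomp t (hasDerivAt_neg t)
    refine h.congr_deriv ?_
    rw [hJR (-t), neg_one_smul]
  have hZ : ∀ t, HasDerivAt (fun t : ℝ => NormedSpace.exp (((t : ℝ) : ℂ) • J) * R (-t)) 0 t := by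
    intro t
    have h := (hE t).mul (hRneg t)
    refine h.congr_deriv ?_
    have hcomm : NormedSpace.exp (((t : ℝ) : ℂ) • J) * J = J * NormedSpace.exp (((t : ℝ) : ℂ) • J) :=
      (((Commute.refl J).smul_right ((t : ℝ) : ℂ)).exp_right).eq.symm
    rw [mul_neg, ← mul_assoc, hcomm, mul_assoc, add_neg_cancel]
  have hconst := is_const_of_deriv_eq_zero (f := fun t : ℝ => NormedSpace.exp (((t : ℝ) : ℂ) • J) * R (-t))
    (fun t => (hZ t).differentiableAt) (fun t => (hZ t).deriv)
  have h0 : NormedSpace.exp ((((0 : ℝ) : ℝ) : ℂ) • J) * R (-0) = 1 := by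
    rw [Complex.ofReal_zero, zero_smul, NormedSpace.exp_zero, one_mul, neg_zero, hR]
    simp only [Real.cos_zero, Real.sin_zero, Complex.ofReal_one, Complex.ofReal_zero, one_smul, zero_smul, add_zero]
  have hθ : NormedSpace.exp (((θ : ℝ) : ℂ) • J) * R (-θ) = 1 := by rw [hconst θ 0]; exact h0
  -- `R(−θ)·R(θ) = 1`
  have hcs : ((Real.cos θ : ℝ) : ℂ) * ((Real.cos θ : ℝ) : ℂ) + ((Real.sin θ : ℝ) : ℂ) * ((Real.sin θ : ℝ) : ℂ) = 1 := by
    have h := Real.cos_sq_add_sin_sq θ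
    rw [sq, sq] at h
    exact_mod_cast h
  have hRR : R (-θ) * R θ = 1 := by
    calc R (-θ) * R θ = (((Real.cos θ : ℝ) : ℂ) * ((Real.cos θ : ℝ) : ℂ) + ((Real.sin θ : ℝ) : ℂ) * ((Real.sin θ : ℝ) : ℂ)) •
          (1 : Matrix (Fin 2) (Fin 2) ℂ) := by
          rw [hR]
          simp only [Real.cos_neg, Real.sin_neg, Complex.ofReal_neg, mul_add, add_mul, smul_mul_assoc, mul_smul_comm, one_mul, mul_one,
            hJ, smul_neg, neg_smul, neg_mul, neg_neg]
          module
      _ = 1 := by rw [hcs, one_smul]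
  calc NormedSpace.exp (((θ : ℝ) : ℂ) • J) = NormedSpace.exp (((θ : ℝ) : ℂ) • J) * (R (-θ) * R θ) := by rw [hRR, mul_one]
    _ = (NormedSpace.exp (((θ : ℝ) : ℂ) • J) * R (-θ)) * R θ := by rw [mul_assoc]
    _ = R θ := by rw [hθ, one_mul]

end Exp

/-! ## §3. The norm-controlled logarithm on `SU(2)` -/

/-- `⟨a • X, a • X⟩_HS = a² ⟨X, X⟩_HS` for a real scalar written as a complex one. [folklore] -/
theorem hsForm_ofReal_smul_self (a : ℝ) (X : Matrix (Fin 2) (Fin 2) ℂ) :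
    hsForm 2 (((a : ℝ) : ℂ) • X) (((a : ℝ) : ℂ) • X) = a * a * hsForm 2 X X := by
  rw [hsForm_apply, hsForm_apply, Matrix.conjTranspose_smul, Matrix.smul_mul, Matrix.mul_smul, smul_smul, Matrix.trace_smul,
    smul_eq_mul]
  have hstar : star ((a : ℝ) : ℂ) = ((a : ℝ) : ℂ) := Complex.conj_ofReal _
  rw [hstar, ← Complex.ofReal_mul, Complex.re_ofReal_mul]

/-- ★★ **Every `U ∈ SU(2)` is `exp X` with `X ∈ 𝔰𝔲(2)` and `⟨X, X⟩_HS ≤ 2π²** (equality for `U = −1`). [folklore] -/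
theorem exists_su2_generator_norm_le (k : Matrix.specialUnitaryGroup (Fin 2) ℂ) :
    ∃ X : Matrix (Fin 2) (Fin 2) ℂ, Xᴴ = -X ∧ X.trace = 0 ∧ NormedSpace.exp X = (k : Matrix (Fin 2) (Fin 2) ℂ) ∧
      hsForm 2 X X ≤ 2 * Real.pi ^ 2 := by
  set U : Matrix (Fin 2) (Fin 2) ℂ := (k : Matrix (Fin 2) (Fin 2) ℂ) with hU
  set c : ℝ := U.trace.re / 2 with hc
  have hc1 : |c| ≤ 1 := abs_re_trace_div_two_le k
  have hcl : -1 ≤ c := (abs_le.1 hc1).1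
  have hcu : c ≤ 1 := (abs_le.1 hc1).2
  set A : Matrix (Fin 2) (Fin 2) ℂ := U - ((c : ℝ) : ℂ) • (1 : Matrix (Fin 2) (Fin 2) ℂ) with hA
  have hAA : A * A = (((c : ℂ)) ^ 2 - 1) • (1 : Matrix (Fin 2) (Fin 2) ℂ) := su2_sub_smul_one_mul_self k
  have hAskew : Aᴴ = -A := su2_sub_smul_one_skew k
  have hAtr : A.trace = 0 := su2_sub_smul_one_trace k
  have hAhs : hsForm 2 A A = 2 * (1 - c ^ 2) := by
    rw [hsForm_apply, hAskew, mul_neg, hAA, Matrix.trace_neg, Matrix.trace_smul, Matrix.trace_one, Fintype.card_fin, smul_eq_mul]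
    have e : (((c : ℂ)) ^ 2 - 1) = (((c ^ 2 - 1 : ℝ)) : ℂ) := by push_cast; ring
    rw [e, Complex.neg_re, show ((2 : ℕ) : ℂ) = ((2 : ℝ) : ℂ) by norm_num, ← Complex.ofReal_mul, Complex.ofReal_re]
    ring
  set θ : ℝ := Real.arccos c with hθ
  have hcos : Real.cos θ = c := Real.cos_arccos hcl hcu
  have hθ0 : 0 ≤ θ := Real.arccos_nonneg c
  have hθπ : θ ≤ Real.pi := Real.arccos_le_pi c
  have hsin0 : 0 ≤ Real.sin θ := Real.sin_nonneg_of_nonneg_of_le_pi hθ0 hθπ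
  have hsin2 : Real.sin θ ^ 2 = 1 - c ^ 2 := by rw [Real.sin_sq, hcos]
  have hθ2 : θ ^ 2 ≤ Real.pi ^ 2 := by nlinarith [Real.pi_pos]
  by_cases hs : Real.sin θ = 0
  · -- `c = ±1`, `A = 0`, `U = c·1`
    have hc2 : c * c = 1 := by nlinarith [hsin2, hs]
    have hA0 : A = 0 := by
      have h : hsForm 2 A A = 0 := by rw [hAhs]; nlinarith [hc2]
      exact hsForm_self_eq_zero.1 h
    have hUc : U = ((c : ℝ) : ℂ) • (1 : Matrix (Fin 2) (Fin 2) ℂ) := by rw [← sub_eq_zero]; exact hA0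
    rcases mul_self_eq_one_iff.mp hc2 with h1 | h1
    · -- `U = 1`: `X = 0`
      refine ⟨0, by simp, by simp, ?_, ?_⟩
      · rw [NormedSpace.exp_zero, hUc, h1]; simp
      · rw [hsForm_apply]; simp only [Matrix.conjTranspose_zero, mul_zero, Matrix.trace_zero, Complex.zero_re]; positivity
    · -- `U = −1`: `X = π·J₀`, `J₀ = diag(i, −i)`
      set J₀ : Matrix (Fin 2) (Fin 2) ℂ := !![Complex.I, 0; 0, -Complex.I] with hJ₀
      have hJ₀sq : J₀ * J₀ = -1 := by
        rw [hJ₀]; ext i j; fin_cases i <;> fin_cases j <;> simp [Matrix.mul_apply, Fin.sum_univ_two]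
      have hJ₀skew : J₀ᴴ = -J₀ := by
        rw [hJ₀]; ext i j; fin_cases i <;> fin_cases j <;> simp [Matrix.conjTranspose_apply]
      have hJ₀tr : J₀.trace = 0 := by rw [hJ₀]; simp [Matrix.trace_fin_two]
      have hJJ : hsForm 2 J₀ J₀ = 2 := by
        rw [hsForm_apply, hJ₀skew, mul_neg, hJ₀sq, neg_neg, Matrix.trace_one, Fintype.card_fin]; norm_num
      refine ⟨((Real.pi : ℝ) : ℂ) • J₀, ?_, ?_, ?_, ?_⟩
      · rw [Matrix.conjTranspose_smul, hJ₀skew, smul_neg]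
        have hstar : star ((Real.pi : ℝ) : ℂ) = ((Real.pi : ℝ) : ℂ) := Complex.conj_ofReal _
        rw [hstar]
      · rw [Matrix.trace_smul, hJ₀tr, smul_zero]
      · rw [exp_smul_of_mul_self_eq_neg_one hJ₀sq, Real.cos_pi, Real.sin_pi, hUc, h1]; simp
      · rw [hsForm_ofReal_smul_self, hJJ]; nlinarith [Real.pi_pos]
  · -- generic case: `J = A / sin θ`, `X = θ·J`
    have hsinpos : 0 < Real.sin θ := lt_of_le_of_ne hsin0 (Ne.symm hs)
    set J : Matrix (Fin 2) (Fin 2) ℂ := (((Real.sin θ)⁻¹ : ℝ) : ℂ) • A with hJ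
    have hcoef : ((((Real.sin θ)⁻¹ : ℝ) : ℂ) * (((Real.sin θ)⁻¹ : ℝ) : ℂ)) * ((c : ℂ) ^ 2 - 1) = -1 := by
      have h1 : ((c : ℂ) ^ 2 - 1) = -((((Real.sin θ) * (Real.sin θ) : ℝ)) : ℂ) := by
        rw [← sq, hsin2]; push_cast; ring
      rw [h1, ← Complex.ofReal_mul, mul_neg, ← Complex.ofReal_mul]
      have h2 : (Real.sin θ)⁻¹ * (Real.sin θ)⁻¹ * (Real.sin θ * Real.sin θ) = 1 := by field_simp
      rw [h2]; simp
    have hJsq : J * J = -1 := by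
      rw [hJ, smul_mul_assoc, mul_smul_comm, hAA, smul_smul, smul_smul, hcoef, neg_one_smul]
    refine ⟨((θ : ℝ) : ℂ) • J, ?_, ?_, ?_, ?_⟩
    · rw [Matrix.conjTranspose_smul, hJ, Matrix.conjTranspose_smul, hAskew, smul_neg, smul_neg]
      have hs1 : star ((θ : ℝ) : ℂ) = ((θ : ℝ) : ℂ) := Complex.conj_ofReal _
      have hs2 : star (((Real.sin θ)⁻¹ : ℝ) : ℂ) = (((Real.sin θ)⁻¹ : ℝ) : ℂ) := Complex.conj_ofReal _
      rw [hs1, hs2]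
    · rw [Matrix.trace_smul, hJ, Matrix.trace_smul, hAtr, smul_zero, smul_zero]
    · rw [exp_smul_of_mul_self_eq_neg_one hJsq θ, hcos, hJ, hA, smul_smul]
      have hss : ((Real.sin θ : ℝ) : ℂ) * (((Real.sin θ)⁻¹ : ℝ) : ℂ) = 1 := by
        rw [← Complex.ofReal_mul, mul_inv_cancel₀ hs]; simp
      rw [hss, one_smul]
      abel
    · rw [hsForm_ofReal_smul_self, hJ, hsForm_ofReal_smul_self, hAhs, ← hsin2]
      have e : θ * θ * ((Real.sin θ)⁻¹ * (Real.sin θ)⁻¹ * (2 * Real.sin θ ^ 2)) = 2 * θ ^ 2 := by field_simp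
      rw [e]; linarith

end Summit.QuantumFields.YangMills.Theorems.ColdStartUniversality
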